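import Summits.ValiantsHypothesis.ValiantsHypothesis.Theorems.GrenetZeonDualUnipotentThreeHalvesHeavyTopBorderOrthogonality
import Summits.ValiantsHypothesis.ValiantsHypothesis.Theorems.GrenetZeonDualUnipotentThreeHalvesHeavyTopBorderEnvelope

/-!
# `GrenetZeon.DualUnipotentThreeHalves` (stmt-ValiantsHypothesis-24318), R2 heavy-top instrument — P-Q1 LEVEL 2 TOOLS
# (lead-g2 `P-Q1-LEVEL2-PORTMAP.md` L2.1 / L2.2 / L2.6): second-order mixed coefficients of a nilpotent pencil, the shift sandwich, the eigenvector lemma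

Experiment cell «val-heavytop-census» (D-0160), engine seat val-htc-eng-2 g3 (kernel-only lane; P-Q1 port, eng lineage, director R336 (5) / R340 (3)).
Level 2 of the lead's pencil proof `lead-g2/Q1-PROOF.md` (Q1 «ι(7) ≤ 19») needs, per the lead's Level-2 port map (crux `CENSUS-P-Q1-LEVEL2-PORTMAP.md`),
the `[x¹z¹]`-parts of `tr((A + zÊ + xŵ)^k)` (identity (E1)) and of `((A + zÊ + xŵ)^s)_{0,s−1}` (identity (E2)), the «shift sandwich»
`(A^a M A^b)_{ij} = M_{i+a, j−b}`, traces against matrix units, and the eigenvector lemma.  THIS FILE types these tools, size-free, on top of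
✓ `HeavyTopPencilFirstOrder` (p688831), ✓ `HeavyTopBorderOrthogonality` (p689547) and ✓ `HeavyTopBorderEnvelope` (p690292):

* `coeff_one_pow_mul_C_mul_pow` — in `S[X]`, any semiring: `[(P^i · C w · P^j)]_1 = [P^i]_1 w [P^j]_0 + [P^i]_0 w [P^j]_1` for `P = C a + C e·X`;
* ★ `trace_mixed_eq_zero` (L2.2, trace form for (E1)) — `(∀ x z, tr((A + z•E + x•W)^{m+1}) = 0) ⇒ Σ_{a<m} tr(W A^a E A^{m−1−a}) = 0`;
* ★ `mixed_eq_zero` (L2.2, matrix form for (E2)) — `(∀ x z, (A + z•E + x•W)^p = 0) ⇒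
  Σ_{i<p} ((Σ_{a<i} A^a E A^{i−1−a}) W A^{p−1−i} + A^i W (Σ_{b<p−1−i} A^b E A^{p−2−i−b})) = 0` (all words with one `E`, one `W`);
* `trace_single_mul` — `tr(E_{pq}(c) N) = c N_{qp}`;  `shift_sandwich_apply` / `shift_sandwich_eq_zero_left/right` (L2.1) — for the shift
  `A = J_n ⊕ 0` on `Fin (n+1)`: `(A^a M A^b)_{q,r} = M_{x,y}` when `x = q+a`, `r = y+b` are available, else `0`;
* `diag_eq_zero_of_col_support` (L2.6, eigenvector lemma) — a nilpotent `Z` whose column `k` is supported on the diagonal has `Z_{kk} = 0`.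

Honest framing: tools for the instrument's kernel port P-Q1 (Level 2); nothing here proves or refutes `HeavyTopLaw`/`HeavyTopSlowLaw`, 24318, S3 or 8062;
`VP ≠ VNP` is NOT proved.  No definitions.  [lead-g2 P-Q1-LEVEL2-PORTMAP (A)–(C); this seat]
-/

noncomputable section

-- single-conjunct layout: Sub = Summit, duplicated namespace component intended
set_option linter.dupNamespace false

namespace Summit.ValiantsHypothesis.ValiantsHypothesis.Theorems.GrenetZeon.HeavyTopLevelTwoTools

open Matrix Polynomial
open Summit.ValiantsHypothesis.ValiantsHypothesis.Theorems.GrenetZeon.HeavyTopPencilFirstOrder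
  (coeff_zero_C_add_C_mul_X_pow coeff_one_C_add_C_mul_X_pow firstOrder_eq_zero_of_forall_pow_eq_zero)
open Summit.ValiantsHypothesis.ValiantsHypothesis.Theorems.GrenetZeon.HeavyTopBorderOrthogonality (trace_firstOrder_eq_zero trace_map_eval)
open Summit.ValiantsHypothesis.ValiantsHypothesis.Theorems.GrenetZeon.HeavyTopBorderEnvelope
  (shift_pow_apply pow_mul_apply_of pow_mul_apply_eq_zero mul_pow_apply_of mul_pow_apply_eq_zero)

/-! ## Second-order mixed coefficients -/

/-- In `S[X]` (any semiring): `[(P^i · C w · P^j)]_1 = [P^i]_1 · w · [P^j]_0 + [P^i]_0 · w · [P^j]_1` where only `coeff 0, 1` of the factors enter. -/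
theorem coeff_one_mul_C_mul {S : Type*} [Semiring S] (f g : S[X]) (w : S) :
    (f * C w * g).coeff 1 = f.coeff 1 * w * g.coeff 0 + f.coeff 0 * w * g.coeff 1 := by
  rw [mul_assoc, Polynomial.coeff_mul, Finset.Nat.sum_antidiagonal_succ, Finset.Nat.antidiagonal_zero, Finset.sum_singleton,
    zero_add, Polynomial.coeff_C_mul, Polynomial.coeff_C_mul, ← mul_assoc, ← mul_assoc, add_comm]

/-- ★ **Mixed second order, trace form** (port map L2.2 for (E1)).  If `tr((A + zE + xW)^{m+1}) = 0` for all `x, z : ℂ`, then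
`Σ_{a<m} tr(W A^a E A^{m−1−a}) = 0` (the `[x¹z¹]`-coefficient: first order in `x` by ✓ `trace_firstOrder_eq_zero`, then the `z¹`-coefficient of
`tr(W (A+zE)^m)` by ✓ `coeff_one_C_add_C_mul_X_pow`). -/
theorem trace_mixed_eq_zero {n : Type*} [Fintype n] [DecidableEq n] (A E W : Matrix n n ℂ) (m : ℕ)
    (h : ∀ x z : ℂ, Matrix.trace ((A + z • E + x • W) ^ (m + 1)) = 0) :
    ∑ a ∈ Finset.range m, Matrix.trace (W * (A ^ a * E * A ^ (m - 1 - a))) = 0 := by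
  classical
  -- first order in `x`: `tr(W (A + zE)^m) = 0` for every `z`
  have h1 : ∀ z : ℂ, Matrix.trace (W * (A + z • E) ^ m) = 0 := fun z =>
    trace_firstOrder_eq_zero (A + z • E) W (m := m + 1) (by omega) (fun x => h x z)
  -- the polynomial `tr(W · Q^m)`, `Q(z) = A + zE`
  set P : (Matrix n n ℂ)[X] := C A + C E * X with hP
  set Q : Matrix n n ℂ[X] := matPolyEquiv.symm P with hQ
  have hQx : ∀ z : ℂ, Q.map (Polynomial.eval z) = A + z • E := by
    intro z
    rw [hQ, matPolyEquiv_symm_map_eval, hP, Polynomial.eval_add, Polynomial.eval_C, Polynomial.eval_mul_X, Polynomial.eval_C]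
    ext i j
    simp [Matrix.scalar_apply, Matrix.mul_diagonal, mul_comm]
  have htr : Matrix.trace (W.map Polynomial.C * Q ^ m) = 0 := by
    apply Polynomial.eq_zero_of_infinite_isRoot
    refine Set.infinite_univ.mono fun z _ => ?_
    rw [Set.mem_setOf_eq, Polynomial.IsRoot, ← trace_map_eval]
    have hmap : (W.map Polynomial.C * Q ^ m).map (Polynomial.eval z) = W * (Q.map (Polynomial.eval z)) ^ m := by
      change (Polynomial.evalRingHom z).mapMatrix (W.map Polynomial.C * Q ^ m) = _
      rw [map_mul, map_pow]
      change (W.map Polynomial.C).map (Polynomial.eval z) * (Q.map (Polynomial.eval z)) ^ m = _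
      congr 1
      ext i j; simp
    rw [hmap, hQx, h1 z]
  have hc : (Matrix.trace (W.map Polynomial.C * Q ^ m)).coeff 1 = Matrix.trace ((matPolyEquiv (W.map Polynomial.C * Q ^ m)).coeff 1) := by
    simp only [Matrix.trace, Matrix.diag_apply, Polynomial.finsetSum_coeff, matPolyEquiv_coeff_apply]
  rw [htr, Polynomial.coeff_zero, map_mul, map_pow, matPolyEquiv_map_C, hQ, AlgEquiv.apply_symm_apply, hP, Polynomial.coeff_C_mul,
    coeff_one_C_add_C_mul_X_pow, Finset.mul_sum, Matrix.trace_sum] at hc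
  exact hc.symm

/-- ★ **Mixed second order, matrix form** (port map L2.2 for (E2)).  If `(A + zE + xW)^p = 0` for all `x, z : ℂ`, then the sum of all words in
`A, E, W` with exactly one `E` and one `W` vanishes:
`Σ_{i<p} ((Σ_{a<i} A^a E A^{i−1−a}) W A^{p−1−i} + A^i W (Σ_{b<p−1−i} A^b E A^{p−2−i−b})) = 0`. -/
theorem mixed_eq_zero {n : Type*} [Fintype n] [DecidableEq n] (A E W : Matrix n n ℂ) (p : ℕ)
    (h : ∀ x z : ℂ, (A + z • E + x • W) ^ p = 0) :
    ∑ i ∈ Finset.range p, ((∑ a ∈ Finset.range i, A ^ a * E * A ^ (i - 1 - a)) * W * A ^ (p - 1 - i) +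
      A ^ i * W * ∑ b ∈ Finset.range (p - 1 - i), A ^ b * E * A ^ (p - 1 - i - 1 - b)) = 0 := by
  classical
  -- first order in `x`: `Σ_i (A+zE)^i W (A+zE)^{p-1-i} = 0` for every `z`
  have h1 : ∀ z : ℂ, ∑ i ∈ Finset.range p, (A + z • E) ^ i * W * (A + z • E) ^ (p - 1 - i) = 0 := fun z =>
    firstOrder_eq_zero_of_forall_pow_eq_zero (A + z • E) W p (fun x => h x z)
  set P : (Matrix n n ℂ)[X] := C A + C E * X with hP
  set S : (Matrix n n ℂ)[X] := ∑ i ∈ Finset.range p, P ^ i * C W * P ^ (p - 1 - i) with hS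
  set Q : Matrix n n ℂ[X] := matPolyEquiv.symm S with hQ
  have hPz : ∀ z : ℂ, (matPolyEquiv.symm P).map (Polynomial.eval z) = A + z • E := by
    intro z
    rw [matPolyEquiv_symm_map_eval, hP, Polynomial.eval_add, Polynomial.eval_C, Polynomial.eval_mul_X, Polynomial.eval_C]
    ext i j
    simp [Matrix.scalar_apply, Matrix.mul_diagonal, mul_comm]
  have hQz : ∀ z : ℂ, Q.map (Polynomial.eval z) = ∑ i ∈ Finset.range p, (A + z • E) ^ i * W * (A + z • E) ^ (p - 1 - i) := by
    intro z
    let φ : (Matrix n n ℂ)[X] →+* Matrix n n ℂ :=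
      (Polynomial.evalRingHom z).mapMatrix.comp matPolyEquiv.symm.toRingEquiv.toRingHom
    have hφ : ∀ T : (Matrix n n ℂ)[X], φ T = (matPolyEquiv.symm T).map (Polynomial.eval z) := fun T => rfl
    have hφP : φ P = A + z • E := by rw [hφ]; exact hPz z
    have hφW : φ (C W) = W := by
      rw [hφ, matPolyEquiv_symm_C]
      ext a b; simp
    rw [hQ, ← hφ, hS, map_sum]
    refine Finset.sum_congr rfl fun i _ => ?_
    rw [map_mul, map_mul, map_pow, map_pow, hφP, hφW]
  have hQ0 : Q = 0 := by
    refine Matrix.ext fun a b => ?_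
    apply Polynomial.eq_zero_of_infinite_isRoot
    refine Set.infinite_univ.mono fun z _ => ?_
    have := congr_fun (congr_fun (hQz z) a) b
    rw [h1 z] at this
    simp only [Polynomial.IsRoot, Set.mem_setOf_eq]
    simpa using this
  have hS0 : S = 0 := by
    have e := congrArg matPolyEquiv hQ0
    rwa [hQ, AlgEquiv.apply_symm_apply, map_zero] at e
  have hc := congrArg (fun f : (Matrix n n ℂ)[X] => f.coeff 1) hS0
  simp only [Polynomial.coeff_zero, hS, Polynomial.finsetSum_coeff] at hc
  rw [← hc]
  refine Finset.sum_congr rfl fun i _ => ?_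
  rw [coeff_one_mul_C_mul, hP, coeff_one_C_add_C_mul_X_pow, coeff_zero_C_add_C_mul_X_pow, coeff_one_C_add_C_mul_X_pow,
    coeff_zero_C_add_C_mul_X_pow]

/-! ## Traces against matrix units; the shift sandwich (L2.1) -/

/-- `tr(E_{pq}(c) · N) = c · N_{qp}`. -/
theorem trace_single_mul {n : Type*} [Fintype n] [DecidableEq n] (p q : n) (c : ℂ) (N : Matrix n n ℂ) :
    Matrix.trace (Matrix.single p q c * N) = c * N q p := by
  rw [Matrix.trace]
  simp only [Matrix.diag_apply]
  rw [Finset.sum_eq_single p]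
  · rw [Matrix.single_mul_apply_same]
  · intro i _ hi
    rw [Matrix.mul_apply]
    exact Finset.sum_eq_zero fun k _ => by rw [Matrix.single_apply_of_row_ne (Ne.symm hi), zero_mul]
  · intro hp; exact absurd (Finset.mem_univ _) hp

/-- ★ **Shift sandwich** (L2.1): for `A = J_n ⊕ 0` on `Fin (n+1)` and any `M`, `(A^a M A^b)_{q,r} = M_{x,y}` when `x = q + a` (`a = 0` or `x` a block index)
and `r = y + b` (`b = 0` or `r` a block index). -/
theorem shift_sandwich_apply {n : ℕ} (A : Matrix (Fin (n + 1)) (Fin (n + 1)) ℂ)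
    (hA : ∀ i j, A i j = if j.val = i.val + 1 ∧ j.val < n then 1 else 0) (a b : ℕ) (M : Matrix (Fin (n + 1)) (Fin (n + 1)) ℂ)
    (q x y r : Fin (n + 1)) (hx : x.val = q.val + a) (ha : a = 0 ∨ x.val < n) (hy : r.val = y.val + b) (hb : b = 0 ∨ r.val < n) :
    (A ^ a * M * A ^ b) q r = M x y := by
  rw [mul_pow_apply_of A hA b (A ^ a * M) q y r hy hb, pow_mul_apply_of A hA a M q x y hx ha]

/-- Shift sandwich, vanishing on the left: if row `q + a` is not available, `(A^a M A^b)_{q,r} = 0`. -/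
theorem shift_sandwich_eq_zero_left {n : ℕ} (A : Matrix (Fin (n + 1)) (Fin (n + 1)) ℂ)
    (hA : ∀ i j, A i j = if j.val = i.val + 1 ∧ j.val < n then 1 else 0) (a b : ℕ) (M : Matrix (Fin (n + 1)) (Fin (n + 1)) ℂ)
    (q r : Fin (n + 1)) (h : ¬ (q.val + a ≤ n ∧ (a = 0 ∨ q.val + a < n))) : (A ^ a * M * A ^ b) q r = 0 := by
  rw [Matrix.mul_assoc]
  exact pow_mul_apply_eq_zero A hA a (M * A ^ b) q r h

/-- Shift sandwich, vanishing on the right: if column `r − b` is not available, `(A^a M A^b)_{q,r} = 0`. -/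
theorem shift_sandwich_eq_zero_right {n : ℕ} (A : Matrix (Fin (n + 1)) (Fin (n + 1)) ℂ)
    (hA : ∀ i j, A i j = if j.val = i.val + 1 ∧ j.val < n then 1 else 0) (a b : ℕ) (M : Matrix (Fin (n + 1)) (Fin (n + 1)) ℂ)
    (q r : Fin (n + 1)) (h : ¬ (b ≤ r.val ∧ (b = 0 ∨ r.val < n))) : (A ^ a * M * A ^ b) q r = 0 :=
  mul_pow_apply_eq_zero A hA b (A ^ a * M) q r h

/-! ## The eigenvector lemma (L2.6) -/

/-- **Eigenvector lemma** (L2.6): if `Z` is nilpotent and its column `k` is supported on the diagonal entry (`Z_{ik} = 0` for `i ≠ k`, i.e.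
`Z e_k = Z_{kk} e_k`), then `Z_{kk} = 0` (so `Z e_k = 0`). -/
theorem diag_eq_zero_of_col_support {n : Type*} [Fintype n] [DecidableEq n] (Z : Matrix n n ℂ) (hZ : IsNilpotent Z) (k : n)
    (h : ∀ i, i ≠ k → Z i k = 0) : Z k k = 0 := by
  obtain ⟨N, hN⟩ := hZ
  -- `(Z^m)_{ik} = Z_{kk}^m [i = k]`
  have key : ∀ m : ℕ, ∀ i, (Z ^ m) i k = if i = k then Z k k ^ m else 0 := by
    intro m
    induction m with
    | zero => intro i; rw [pow_zero, Matrix.one_apply, pow_zero]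
    | succ m ih =>
      intro i
      rw [pow_succ, Matrix.mul_apply, Finset.sum_eq_single k]
      · rw [ih]
        by_cases hi : i = k
        · subst hi; simp [pow_succ]
        · simp [hi]
      · intro j _ hj; rw [h j hj, mul_zero]
      · intro hk; exact absurd (Finset.mem_univ _) hk
  have e := key N k
  rw [hN, Matrix.zero_apply, if_pos rfl] at e
  exact pow_eq_zero_iff'.1 e.symm |>.1

end Summit.ValiantsHypothesis.ValiantsHypothesis.Theorems.GrenetZeon.HeavyTopLevelTwoTools

end
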